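import Summits.ValiantsHypothesis.ValiantsHypothesis.Theorems.BarrierLeverDefinableEquationsUnipotentCoefficients
import Summits.ValiantsHypothesis.ValiantsHypothesis.Theorems.BarrierLeverDefinableEquationsLeadingForm

/-!
# Cruxes `BarrierLever.DefinableEquations` (8745) / `SingleSizeEquations` (8749) — `U`-INVARIANTS:
# the top root-height component of the generic translate is invariant under the unipotent radical

Fifth file of the "U-half" of the normal-form programme (design memo `HWV-NORMAL-FORM-PLAN.md`,
evidence #9 on stmt-ValiantsHypothesis-8749).  Let `G(s, c) = E(T_s c)` be the generic unipotent
translate of an equation `E` (`…UnipotentCoefficients.lean`) and give the group parameter `s_kj` the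
ROOT HEIGHT `j - k` as weight (`heightW`; the coefficient variables get weight `0`).  Two
substitutions act on `G`: `actSubst t` (`c ↦ T_t c`, the coefficient action, numeric `t`) and
`lawSubst t` (`s ↦ s ⋆ t`, the group law of `…UnipotentAction.lean`).  The action law
`T_s (T_t c) = T_{s ⋆ t} c` says they agree on `G` (`aeval_actSubst_eq_aeval_lawSubst`, via
`MvPolynomial.funext`); `actSubst` preserves root heights while `lawSubst` is UNITRIANGULAR for them
(`s_kj ↦ s_kj + t_kj + Σ_{k<i<j} t_ij s_ki`: lower heights only).  Hence, by the leading-form lemma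
of `…LeadingForm.lean`, the top root-height component `G_top` of `G` satisfies
`G_top(s, T_t c) = G_top(s, c)` for all `t` (`eval_top_uAct`) — every specialisation `G_top(s₀, ·)`
is a `U`-INVARIANT polynomial in the coefficient variables.  Also: every root-height component of
`G` vanishes at `(s, c)` for all `s` as soon as `G(·, c) ≡ 0` (`eval_component_eq_zero_of_forall`,
torus restriction).

Elementary; small definitions (`heightW`, `actSubst`, `lawSubst` abbreviate explicit expressions),
no named facts.  HONEST FRAMING: infrastructure for a normal form; nothing here bears on the open
content of the cruxes.  References: [LandsbergGCT2017] §8 (highest weight vectors);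
[Burgisser2000] Rem. 2.7.
-/

-- layout Summits/ValiantsHypothesis/ValiantsHypothesis forces the duplicated namespace component
set_option linter.dupNamespace false

noncomputable section

open MvPolynomial

namespace Summit.ValiantsHypothesis.ValiantsHypothesis.Theorems.BarrierLever.IsobaricEquations

open Literature.Computability.AlgebraicComplexity Literature.Barriers.ValiantsHypothesis
open Summit.ValiantsHypothesis.ValiantsHypothesis.Theorems.BarrierLever.SuccinctHittingSetsForVP

variable {n : ℕ}

/-! ## §7 The `U`-invariant extraction -/

section invariants

/-- The ROOT-HEIGHT weight on the variables `s ⊕ c`: `W(s_kj) = j - k`, `W(c_m) = 0`. [folklore] -/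
def heightW (n : ℕ) : (Fin n × Fin n) ⊕ degLEMonomials n → ℕ :=
  Sum.elim (fun p => (p.2 : ℕ) - (p.1 : ℕ)) (fun _ => 0)

/-- `unip` only reads the entries `s_ij`, `i < j`. [folklore] -/
theorem unip_congr {s s' : Fin n → Fin n → ℂ} (h : ∀ i j : Fin n, i < j → s i j = s' i j) :
    unip s = unip s' := by
  funext j
  rw [unip_apply, unip_apply]
  congr 1
  refine Finset.sum_congr rfl fun i hi => ?_
  rw [h i j (Finset.mem_filter.mp hi).2]

/-- The group law `s ↦ s ⋆ t` as a substitution of the `s`-variables (the `c`-variables fixed):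
`s_kj ↦ s_kj + t_kj + Σ_{k<i<j} t_ij s_ki` for `k < j`. [folklore] -/
def lawSubst (t : Fin n → Fin n → ℂ) :
    (Fin n × Fin n) ⊕ degLEMonomials n → MvPolynomial ((Fin n × Fin n) ⊕ degLEMonomials n) ℂ
  | Sum.inl p => if p.1 < p.2 then X (Sum.inl p) + (C (t p.1 p.2) +
      ∑ i ∈ Finset.univ.filter (fun i : Fin n => p.1 < i ∧ i < p.2), C (t i p.2) * X (Sum.inl (p.1, i)))
      else X (Sum.inl p)
  | Sum.inr m => X (Sum.inr m)

/-- Semantics of `lawSubst`: evaluation at `(s, c)` after the substitution is evaluation at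
`(s ⋆ t, c)`, up to entries `k ≥ j` that `u` never reads. [folklore] -/
theorem eval_aeval_lawSubst (t s : Fin n → Fin n → ℂ) (c : degLEMonomials n → ℂ)
    (P : MvPolynomial ((Fin n × Fin n) ⊕ degLEMonomials n) ℂ) :
    eval (spt s c) (aeval (lawSubst t) P) =
      eval (spt (fun k j => if k < j then ulaw s t k j else s k j) c) P := by
  have hpt : (fun v => eval (spt s c) (lawSubst t v)) =
      spt (fun k j => if k < j then ulaw s t k j else s k j) c := by
    funext v
    rcases v with p | m
    · by_cases hp : p.1 < p.2
      · rw [lawSubst, if_pos hp, spt, spt, Sum.elim_inl, if_pos hp, ulaw]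
        simp only [map_add, map_sum, map_mul, eval_C, eval_X, Sum.elim_inl]
        rw [add_assoc]
        congr 2
        exact Finset.sum_congr rfl fun i _ => mul_comm _ _
      · rw [lawSubst, if_neg hp, spt, spt, eval_X, Sum.elim_inl, Sum.elim_inl, if_neg hp]
    · rw [lawSubst, eval_X, spt, spt, Sum.elim_inr, Sum.elim_inr]
  rw [BoolSumComponents.eval_aeval_eq, hpt]

/-- Every point of the variable space `s ⊕ c` is of the form `(s, c)`. [folklore] -/
theorem spt_eta (x : (Fin n × Fin n) ⊕ degLEMonomials n → ℂ) :
    spt (fun i j => x (Sum.inl (i, j))) (x ∘ Sum.inr) = x := by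
  funext v; rcases v with ⟨i, j⟩ | m <;> rfl

/-- `lawSubst` is unitriangular for the root-height weight: `s_kj ↦ s_kj + (terms of height < j - k)`.
[folklore] -/
theorem lawSubst_unitri (t : Fin n → Fin n → ℂ) (v : (Fin n × Fin n) ⊕ degLEMonomials n) :
    ∀ γ ∈ (lawSubst t v - X v).support, Finsupp.weight (heightW n) γ < heightW n v := by
  classical
  rcases v with p | m
  · by_cases hp : p.1 < p.2
    · rw [lawSubst, if_pos hp, add_sub_cancel_left]
      intro γ hγ
      rcases Finset.mem_union.mp (support_add hγ) with h | h
      · -- the constant `t_kj`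
        have h0 : γ = 0 := by
          rw [C_apply] at h
          exact Finset.mem_singleton.mp (support_monomial_subset h)
        rw [h0, map_zero, heightW, Sum.elim_inl]
        exact Nat.sub_pos_of_lt hp
      · obtain ⟨i, hi, hγi⟩ := Finset.mem_biUnion.mp (support_sum h)
        rw [C_mul'] at hγi
        have hγ' := support_smul hγi
        rw [support_X, Finset.mem_singleton] at hγ'
        rw [hγ', Finsupp.weight_single, smul_eq_mul, one_mul, heightW, Sum.elim_inl, Sum.elim_inl]
        obtain ⟨hki, hij⟩ := (Finset.mem_filter.mp hi).2
        simp only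
        have := Fin.lt_def.mp hki
        have := Fin.lt_def.mp hij
        omega
    · rw [lawSubst, if_neg hp, sub_self]
      simp
  · rw [lawSubst, sub_self]; simp

variable [Fintype (degLEMonomials n)]

/-- The coefficient action `T_t` as a substitution of the `c`-variables (the `s`-variables fixed):
`c_m ↦ Σ_{m'} A^t_{m m'} c_{m'}`. [folklore] -/
def actSubst (t : Fin n → Fin n → ℂ) :
    (Fin n × Fin n) ⊕ degLEMonomials n → MvPolynomial ((Fin n × Fin n) ⊕ degLEMonomials n) ℂ
  | Sum.inl p => X (Sum.inl p)
  | Sum.inr m => ∑ m' : degLEMonomials n,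
      C (coeff (m : Fin n →₀ ℕ) (aeval (unip t) (monomial (m' : Fin n →₀ ℕ) (1 : ℂ)))) * X (Sum.inr m')

/-- Semantics of `actSubst`: evaluation at `(s, c)` after the substitution is evaluation at
`(s, T_t c)`. [folklore] -/
theorem eval_aeval_actSubst (t s : Fin n → Fin n → ℂ) (c : degLEMonomials n → ℂ)
    (P : MvPolynomial ((Fin n × Fin n) ⊕ degLEMonomials n) ℂ) :
    eval (spt s c) (aeval (actSubst t) P) = eval (spt s (uAct t c)) P := by
  have hpt : (fun v => eval (spt s c) (actSubst t v)) = spt s (uAct t c) := by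
    funext v
    rcases v with p | m
    · rw [actSubst, eval_X, spt, spt, Sum.elim_inl, Sum.elim_inl]
    · rw [actSubst, map_sum, spt, spt, Sum.elim_inr, uAct_eq_sum]
      refine Finset.sum_congr rfl fun m' _ => ?_
      rw [map_mul, eval_C, eval_X, Sum.elim_inr]
  rw [BoolSumComponents.eval_aeval_eq, hpt]

/-- **The action identity**: on the generic translate `G` (any polynomial with
`G(s, c) = E(T_s c)`), substituting `c ↦ T_t c` equals substituting `s ↦ s ⋆ t` (the group law
`T_s (T_t c) = T_{s ⋆ t} c`). [folklore] -/
theorem aeval_actSubst_eq_aeval_lawSubst {G : MvPolynomial ((Fin n × Fin n) ⊕ degLEMonomials n) ℂ}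
    {E : MvPolynomial (degLEMonomials n) ℂ}
    (hG : ∀ (s : Fin n → Fin n → ℂ) (c : degLEMonomials n → ℂ), eval (spt s c) G = eval (uAct s c) E)
    (t : Fin n → Fin n → ℂ) : aeval (actSubst t) G = aeval (lawSubst t) G := by
  refine MvPolynomial.funext fun x => ?_
  have hu : uAct (ulaw (fun i j => x (Sum.inl (i, j))) t) (x ∘ Sum.inr) =
      uAct (fun k j => if k < j then ulaw (fun i j => x (Sum.inl (i, j))) t k j else x (Sum.inl (k, j)))
        (x ∘ Sum.inr) := by
    unfold uAct
    rw [unip_congr (s' := fun k j => if k < j then ulaw (fun i j => x (Sum.inl (i, j))) t k j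
      else x (Sum.inl (k, j)))]
    intro i j hij
    rw [if_pos hij]
  rw [← spt_eta x, eval_aeval_actSubst, eval_aeval_lawSubst, hG, hG, uAct_uAct, hu]

/-- `actSubst` preserves the root-height weight (it only touches weight-`0` variables).
[folklore] -/
theorem isWeightedHomogeneous_actSubst (t : Fin n → Fin n → ℂ) (v : (Fin n × Fin n) ⊕ degLEMonomials n) :
    IsWeightedHomogeneous (heightW n) (actSubst t v) (heightW n v) := by
  rcases v with p | m
  · rw [actSubst]; exact isWeightedHomogeneous_X (R := ℂ) (heightW n) _
  · rw [actSubst]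
    refine IsWeightedHomogeneous.sum _ _ _ fun m' _ => ?_
    exact (isWeightedHomogeneous_X (R := ℂ) (heightW n)
      (Sum.inr m' : (Fin n × Fin n) ⊕ degLEMonomials n)).C_mul _

end invariants

section extraction

/-- Torus points for the root-height weight: scaling `s_kj ↦ τ^{j-k} s_kj` is again a point
`(s', c)`. [folklore] -/
theorem torus_spt (τ : ℂ) (s : Fin n → Fin n → ℂ) (c : degLEMonomials n → ℂ) :
    (fun v => τ ^ heightW n v * spt s c v) =
      spt (fun i j => τ ^ ((j : ℕ) - (i : ℕ)) * s i j) c := by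
  funext v
  rcases v with ⟨i, j⟩ | m
  · rfl
  · simp [heightW, spt]

/-- **Every root-height component of `G` vanishes wherever `G(·, c)` vanishes identically in `s`.**
[folklore] -/
theorem eval_component_eq_zero_of_forall {G : MvPolynomial ((Fin n × Fin n) ⊕ degLEMonomials n) ℂ}
    {c : degLEMonomials n → ℂ} (hc : ∀ s : Fin n → Fin n → ℂ, eval (spt s c) G = 0)
    (s : Fin n → Fin n → ℂ) (d : ℕ) :
    eval (spt s c) (weightedHomogeneousComponent (heightW n) d G) = 0 := by
  refine Isobaric.eval_weightedHomogeneousComponent_eq_zero (fun τ => ?_) d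
  rw [torus_spt]
  exact hc _

/-- Specialising the `s`-variables to constants `s₀`: evaluation. [folklore] -/
theorem eval_aeval_const (s₀ : Fin n × Fin n → ℂ) (c : degLEMonomials n → ℂ)
    (P : MvPolynomial ((Fin n × Fin n) ⊕ degLEMonomials n) ℂ) :
    eval c (aeval (Sum.elim (fun p => C (s₀ p)) X :
      (Fin n × Fin n) ⊕ degLEMonomials n → MvPolynomial (degLEMonomials n) ℂ) P) =
      eval (spt (fun i j => s₀ (i, j)) c) P := by
  have hpt : (fun v => eval c ((Sum.elim (fun p => C (s₀ p)) X :
      (Fin n × Fin n) ⊕ degLEMonomials n → MvPolynomial (degLEMonomials n) ℂ) v)) =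
      spt (fun i j => s₀ (i, j)) c := by
    funext v
    rcases v with ⟨i, j⟩ | m
    · simp [spt]
    · simp [spt]
  rw [BoolSumComponents.eval_aeval_eq, hpt]

variable [Fintype (degLEMonomials n)]

/-- **The top root-height component of the generic translate is `U`-invariant**:
`G_top(s, T_t c) = G_top(s, c)`. [folklore] -/
theorem aeval_actSubst_top {G : MvPolynomial ((Fin n × Fin n) ⊕ degLEMonomials n) ℂ}
    {E : MvPolynomial (degLEMonomials n) ℂ}
    (hG : ∀ (s : Fin n → Fin n → ℂ) (c : degLEMonomials n → ℂ), eval (spt s c) G = eval (uAct s c) E)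
    (t : Fin n → Fin n → ℂ) :
    aeval (actSubst t) (weightedHomogeneousComponent (heightW n) (weightedTotalDegree (heightW n) G) G) =
      weightedHomogeneousComponent (heightW n) (weightedTotalDegree (heightW n) G) G := by
  rw [← Isobaric.weightedHomogeneousComponent_aeval (heightW n) (heightW n) (actSubst t)
    (isWeightedHomogeneous_actSubst t), aeval_actSubst_eq_aeval_lawSubst hG t]
  exact weightedHomogeneousComponent_aeval_unitri (heightW n) (lawSubst_unitri t) G _
    fun α hα => le_weightedTotalDegree (heightW n) hα

/-- Pointwise form: `G_top(s, T_t c) = G_top(s, c)`. [folklore] -/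
theorem eval_top_uAct {G : MvPolynomial ((Fin n × Fin n) ⊕ degLEMonomials n) ℂ}
    {E : MvPolynomial (degLEMonomials n) ℂ}
    (hG : ∀ (s : Fin n → Fin n → ℂ) (c : degLEMonomials n → ℂ), eval (spt s c) G = eval (uAct s c) E)
    (t s : Fin n → Fin n → ℂ) (c : degLEMonomials n → ℂ) :
    eval (spt s (uAct t c))
        (weightedHomogeneousComponent (heightW n) (weightedTotalDegree (heightW n) G) G) =
      eval (spt s c) (weightedHomogeneousComponent (heightW n) (weightedTotalDegree (heightW n) G) G) := by
  rw [← eval_aeval_actSubst, aeval_actSubst_top hG]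

end extraction

end Summit.ValiantsHypothesis.ValiantsHypothesis.Theorems.BarrierLever.IsobaricEquations

end
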